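import Summits.Ventures.LatticeQCDFlow.Scaling.FlowLadderModeGap
import Summits.Ventures.LatticeQCDFlow.Scaling.FlowTemperingConjugacy

/-!
HONEST FRAMING: exact (Metropolis-corrected) sampling algorithms for lattice gauge theory; figures
of merit are autocorrelation/cost numbers at stated couplings and volumes; no continuum-physics
claim.

# FlowTemperingModeGap — SECTOR-PRESERVING TRANSPORT MAPS IN SIMULATED TEMPERING: THE MODE-GAP FLOOR OF
# `Scaling/SimulatedTemperingModeGap` HOLDS FOR `stFlowSampler ½ μ M φ` WITH THE SECTOR-WISE TRANSPORT OVERLAP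
# `Σ_{u ∈ A_j} min{μ_l(u), μ_{l+1}(φ_l u)}` IN PLACE OF THE SECTOR-WISE OVERLAP:
# `Gap ≥ p γ_A·min{δ^φ/K, γ₀}/(25(K+1))` (lean-2 GEN-21, ours)

Venture-side (OURS).  Cell `lqcd-flow` (pub-lqcd), unit `pub-lqcd-lean-2-g21`, 2026-08-26.  Chapter I, seventh file; the
tempering twin of `Scaling/FlowLadderModeGap`.  `Scaling/SimulatedTemperingModeGap` (Y3) proved for the plain tempering
sampler `stFinSampler ½ μ M`: with persistence `p` of the sector weights down the ladder, sector-wise adjacent overlaps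
`δ·min{μ_l(A_j), μ_{l+1}(A_j)} ≤ Σ_{x ∈ A_j} min{μ_l(x), μ_{l+1}(x)}`, within-sector Poincaré constant `γ_A` of every
within-level update and a global Poincaré constant `γ₀` of the hot one, `Gap ≥ p γ_A·min{δ/K, γ₀}/(25(K+1))`.  By the
level coordinates of `Scaling/FlowTemperingConjugacy` (`stFlowSampler t μ M φ^L` IS `stFinSampler t ν M^L` for
`ν_k = μ_k∘L_k⁻¹`) and the sector-preserving relabelling lemmas of `Scaling/FlowLadderModeGap`, the same floor holds
for the sampler with transport moves through SECTOR-PRESERVING bijections `φ_j`, with `δ` now the sector-wise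
TRANSPORT overlap: `δ·min{μ_l(A_j), μ_{l+1}(A_j)} ≤ Σ_{u ∈ A_j} min{μ_l(u), μ_{l+1}(φ_l u)}` — the sector-wise
acceptance mass of the transport move.

## What is proved

* `transportOverlap_relabel` (`Σ_{x∈A_j} min{ν_l(x), ν_{l+1}(x)} = Σ_{u∈A_j} min{μ_l(u), μ_{l+1}(φ^L_l u)}`);
  **`flowTemperingMode_spectralGap_ge_levelMaps`**; the `φ`-form **`flowTemperingMode_spectralGap_ge`**:
  sector-preserving `φ_j`, `K ≥ 1` ⇒ `Gap(stFlowSampler ½ μ M φ) ≥ p γ_A·min{δ/K, γ₀}/(25(K+1))`.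
* `blockMass_eq_of_perfect_sectorPreserving`, **`blockMass_eq_hot_of_perfect_sectorPreserving`** — a sector-preserving
  map is a perfect transport only between levels with EQUAL sector weights (`μ_k(A_j) = μ_0(A_j)` for all `k`): perfect
  transports across a sector-weight barrier are tunnelling moves themselves.

Reading (no numerics implied): in tempering as in replica exchange, a sector-preserving flow between neighbouring
couplings can push the sector-wise acceptance of the level moves to one; the tunnelling is the hot update's (`γ₀`),
and the persistence `p` of the sector WEIGHTS along the ladder is untouched by any such map.  NOT CLAIMED: maps moving
mass between sectors; anything measured.  Literature grade (cell rule): OWN MECHANISM, NEW TYPING; nothing cited as a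
fact; no new bib keys.
-/

noncomputable section

open Finset Function
open Literature.Probability.MarkovChains
open Literature.Probability.MarkovChains.Decomposition

namespace Summit.Ventures.LatticeQCDFlow.Scaling

section ModeGap

variable {S J : Type*} [Fintype S] [DecidableEq S] [Fintype J] [DecidableEq J] {K : ℕ}
  {μ : Fin (K + 1) → S → ℝ} {M : Fin (K + 1) → Matrix S S ℝ} {mode : S → J}

omit [Fintype S] [DecidableEq S] [Fintype J] in
/-- **The sector-wise adjacent overlap of the pulled-back laws is the sector-wise transport overlap:**
`Σ_{x ∈ A_j} min{ν_l(x), ν_{l+1}(x)} = Σ_{u ∈ A_j} min{μ_l(u), μ_{l+1}(φ^L_l u)}` for sector-preserving `L`. [ours] -/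
theorem transportOverlap_relabel [Fintype S] (L : Fin (K + 1) → Equiv.Perm S)
    (hLmode : ∀ (i : Fin (K + 1)) (u : S), mode (L i u) = mode u) (l : Fin K) (j : J) :
    ∑ x ∈ block mode j, min (μ l.castSucc ((L l.castSucc).symm x)) (μ l.succ ((L l.succ).symm x))
      = ∑ u ∈ block mode j, min (μ l.castSucc u) (μ l.succ (((L l.castSucc).trans (L l.succ).symm) u)) := by
  rw [← sum_block_relabel (L l.castSucc) (hLmode l.castSucc) j
    (fun x => min (μ l.castSucc ((L l.castSucc).symm x)) (μ l.succ ((L l.succ).symm x)))]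
  simp only [Equiv.symm_apply_apply, Equiv.trans_apply]

/-- **THE TEMPERING MODE-GAP FLOOR IN LEVEL COORDINATES:** sector-preserving level maps (`L_0 = 1`), persistence `p`,
within-sector Poincaré constant `γ_A`, hot global Poincaré constant `γ₀`, and the sector-wise TRANSPORT overlap `δ`:
`Gap(stFlowSampler ½ μ M φ^L) ≥ p γ_A·min{δ/K, γ₀}/(25(K+1))`. [ours] -/
theorem flowTemperingMode_spectralGap_ge_levelMaps (L : Fin (K + 1) → Equiv.Perm S) (hL0 : L 0 = Equiv.refl S)
    (hLmode : ∀ (i : Fin (K + 1)) (u : S), mode (L i u) = mode u)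
    (hμ : ∀ k x, 0 < μ k x) (hμ1 : ∀ k, ∑ x, μ k x = 1) (hmode : Function.Surjective mode) (hK : 1 ≤ K)
    (hM : ∀ k, IsRowStochastic (M k)) (hMrev : ∀ k, DetailedBalance (μ k) (M k))
    {p δ γ₀ γA : ℝ} (hp : 0 < p) (hp1 : p ≤ 1) (hδ0 : 0 < δ) (hδ1 : δ ≤ 1) (hγ₀ : 0 < γ₀) (hγA : 0 < γA) (hγA1 : γA ≤ 1)
    (hpers : ∀ (k l : Fin (K + 1)) (j : J), k ≤ l → p * blockMass (μ l) mode j ≤ blockMass (μ k) mode j)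
    (hδ : ∀ (l : Fin K) (j : J), δ * min (blockMass (μ l.castSucc) mode j) (blockMass (μ l.succ) mode j)
      ≤ ∑ u ∈ block mode j, min (μ l.castSucc u) (μ l.succ (((L l.castSucc).trans (L l.succ).symm) u)))
    (hgap0 : ∀ h : S → ℝ, γ₀ * lawVariance (μ 0) h ≤ dirichletForm (μ 0) (M 0) h)
    (hgapA : ∀ k j, ∀ h : S → ℝ, γA * lawVariance (blockLaw (μ k) mode j) h
      ≤ dirichletForm (blockLaw (μ k) mode j) (restrictionChain (M k) mode) h) :
    p * γA * min (δ / K) γ₀ / (25 * (K + 1))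
      ≤ spectralGap (stFinLaw μ) (stFlowSampler (1 / 2) μ M (fun j : Fin K => (L j.castSucc).trans (L j.succ).symm)) := by
  rw [stFlowSampler_spectralGap_eq_conj L hμ (1 / 2) M]
  have hLmode' : ∀ (i : Fin (K + 1)) (u : S), mode ((L i).symm u) = mode u := fun i u => by
    have h := hLmode i ((L i).symm u); rw [Equiv.apply_symm_apply] at h; exact h.symm
  have hL0u : ∀ u, (L 0).symm u = u := fun u => by rw [hL0]; rfl
  have hν0 : (fun u => μ 0 ((L 0).symm u)) = μ 0 := funext fun u => by rw [hL0u]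
  have hM0 : (Matrix.of fun u v => M 0 ((L 0).symm u) ((L 0).symm v)) = M 0 := by
    ext u v; rw [Matrix.of_apply, hL0u, hL0u]
  have hbm : ∀ (k : Fin (K + 1)) (j : J), blockMass (fun u => μ k ((L k).symm u)) mode j = blockMass (μ k) mode j :=
    fun k j => blockMass_relabel (L k).symm (hLmode' k) (μ k) j
  refine stFinModeHalf_spectralGap_ge (μ := fun i u => μ i ((L i).symm u))
    (M := fun i => Matrix.of fun u v => M i ((L i).symm u) ((L i).symm v)) (mode := mode) (fun k u => hμ k _)
    (fun k => by rw [Equiv.sum_comp (L k).symm (μ k)]; exact hμ1 k) hmode hK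
    (fun k => ⟨fun u v => (hM k).1 _ _, fun u => ?_⟩) (fun k u v => ?_) hp hp1 hδ0 hδ1 hγ₀ hγA hγA1
    (fun k l j hkl => by rw [hbm, hbm]; exact hpers k l j hkl) (fun l j => ?_) ?_ (fun k j h => ?_)
  · simpa using (Equiv.sum_comp (L k).symm (fun v => M k ((L k).symm u) v)).trans ((hM k).2 _)
  · simp only [Matrix.of_apply]; exact hMrev k _ _
  · rw [hbm, hbm, transportOverlap_relabel L hLmode l j]; exact hδ l j
  · intro h
    have e1 : lawVariance (fun u => μ 0 ((L 0).symm u)) h = lawVariance (μ 0) h := by rw [hν0]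
    have e2 : dirichletForm (fun u => μ 0 ((L 0).symm u)) (Matrix.of fun u v => M 0 ((L 0).symm u) ((L 0).symm v)) h
        = dirichletForm (μ 0) (M 0) h := by rw [hν0, hM0]
    rw [e1, e2]; exact hgap0 h
  · have e : (Matrix.of fun u v => M k ((L k).symm u) ((L k).symm v)) = fun u v => M k ((L k).symm u) ((L k).symm v) := by
      ext u v; rfl
    rw [e]
    exact blockPoincare_relabel (L k).symm (hLmode' k) j (hgapA k j) h

/-- **THE MODE-GAP FLOOR FOR TEMPERING WITH SECTOR-PRESERVING TRANSPORT MAPS:** for adjacent bijections with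
`mode(φ_j u) = mode(u)` (`K ≥ 1`), persistence `p`, within-sector Poincaré constant `γ_A`, hot global Poincaré constant
`γ₀`, and the sector-wise transport overlap `δ·min{μ_l(A_j), μ_{l+1}(A_j)} ≤ Σ_{u ∈ A_j} min{μ_l(u), μ_{l+1}(φ_l u)}`:
`Gap(stFlowSampler ½ μ M φ) ≥ p γ_A·min{δ/K, γ₀}/(25(K+1))`. [ours] -/
theorem flowTemperingMode_spectralGap_ge (φ : Fin K → Equiv.Perm S) (hφmode : ∀ (j : Fin K) (u : S), mode (φ j u) = mode u)
    (hμ : ∀ k x, 0 < μ k x) (hμ1 : ∀ k, ∑ x, μ k x = 1) (hmode : Function.Surjective mode) (hK : 1 ≤ K)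
    (hM : ∀ k, IsRowStochastic (M k)) (hMrev : ∀ k, DetailedBalance (μ k) (M k))
    {p δ γ₀ γA : ℝ} (hp : 0 < p) (hp1 : p ≤ 1) (hδ0 : 0 < δ) (hδ1 : δ ≤ 1) (hγ₀ : 0 < γ₀) (hγA : 0 < γA) (hγA1 : γA ≤ 1)
    (hpers : ∀ (k l : Fin (K + 1)) (j : J), k ≤ l → p * blockMass (μ l) mode j ≤ blockMass (μ k) mode j)
    (hδ : ∀ (l : Fin K) (j : J), δ * min (blockMass (μ l.castSucc) mode j) (blockMass (μ l.succ) mode j)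
      ≤ ∑ u ∈ block mode j, min (μ l.castSucc u) (μ l.succ (φ l u)))
    (hgap0 : ∀ h : S → ℝ, γ₀ * lawVariance (μ 0) h ≤ dirichletForm (μ 0) (M 0) h)
    (hgapA : ∀ k j, ∀ h : S → ℝ, γA * lawVariance (blockLaw (μ k) mode j) h
      ≤ dirichletForm (blockLaw (μ k) mode j) (restrictionChain (M k) mode) h) :
    p * γA * min (δ / K) γ₀ / (25 * (K + 1)) ≤ spectralGap (stFinLaw μ) (stFlowSampler (1 / 2) μ M φ) := by
  obtain ⟨L, hL0, hLφ⟩ := exists_levelMaps φ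
  have hφ : φ = fun j : Fin K => (L j.castSucc).trans (L j.succ).symm := (funext hLφ).symm
  have hLmode' := ladderRelabel_mode (mode := mode) L hL0 φ hLφ hφmode
  have hLmode : ∀ (i : Fin (K + 1)) (u : S), mode (L i u) = mode u := fun i u => by
    have h := hLmode' i (L i u); rw [Equiv.symm_apply_apply] at h; exact h.symm
  subst hφ
  exact flowTemperingMode_spectralGap_ge_levelMaps L hL0 hLmode hμ hμ1 hmode hK hM hMrev hp hp1 hδ0 hδ1 hγ₀ hγA hγA1
    hpers hδ hgap0 hgapA

/-! ## Sector-preserving AND perfect forces equal sector weights -/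

omit [DecidableEq S] [Fintype J] in
/-- **A sector-preserving bijection that transports `ν` onto `ν'` equalises their sector weights:** `mode∘φ = mode` and
`ν'(φ u) = ν(u)` for all `u` ⇒ `ν'(A_j) = ν(A_j)` for every sector. [ours] -/
theorem blockMass_eq_of_perfect_sectorPreserving (φ : Equiv.Perm S) (hφmode : ∀ u : S, mode (φ u) = mode u)
    {ν ν' : S → ℝ} (hperf : ∀ u : S, ν' (φ u) = ν u) (j : J) : blockMass ν' mode j = blockMass ν mode j := by
  unfold blockMass
  rw [← sum_block_relabel φ hφmode j ν']
  exact sum_congr rfl fun u _ => hperf u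

omit [DecidableEq S] [Fintype J] in
/-- **Hence perfect sector-preserving adjacent transports exist only on ladders with CONSTANT sector weights:**
`μ_{j+1}(φ_j u) = μ_j(u)` and `mode(φ_j u) = mode(u)` for all `j`, `u` ⇒ `μ_k(A_j) = μ_0(A_j)` for every level `k` and
sector `j` — where there is no free-energy barrier between the levels' sector weights left to cross (`p = q = 1` in
the floors above); a perfect transport between levels with different sector weights necessarily moves mass between
sectors, i.e. it is itself a tunnelling move. [ours] -/
theorem blockMass_eq_hot_of_perfect_sectorPreserving (φ : Fin K → Equiv.Perm S)
    (hφmode : ∀ (j : Fin K) (u : S), mode (φ j u) = mode u)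
    (hperfect : ∀ (j : Fin K) (u : S), μ j.succ (φ j u) = μ j.castSucc u) (k : Fin (K + 1)) (j : J) :
    blockMass (μ k) mode j = blockMass (μ 0) mode j := by
  induction k using Fin.induction with
  | zero => rfl
  | succ i ih => rw [blockMass_eq_of_perfect_sectorPreserving (φ i) (hφmode i) (hperfect i) j, ih]

end ModeGap

end Summit.Ventures.LatticeQCDFlow.Scaling

end
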